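import Summits.BirchSwinnertonDyer.BirchSwinnertonDyer.Theorems.MordellShaFreeCutBDPTripleUpToCensus
import Summits.BirchSwinnertonDyer.BirchSwinnertonDyer.Theorems.CongruentShaFreeCutTextbookDualityImQuad

set_option linter.dupNamespace false
set_option autoImplicit false

/-! # Route `MordellShaFreeCut` (rung S2b), residual crux A `RankPosOfThreeSelmerCorankOne`
(stmt-BirchSwinnertonDyer-19159) and the leaf — the kernel census WITH NO TEXTBOOK HYPOTHESIS

Cell `bsd-cn100`, prover seat `bsd-cn100-s2b-c3` (g5). Supports, does not close,
stmt-BirchSwinnertonDyer-19159 (and serves stmt-BirchSwinnertonDyer-19160 through the leaf). After the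
cell's (F1) campaign the Poitou–Tate reciprocity law `∑_v inv_v = 0` on `H²(Γ_K, μ_n)` is a TREE THEOREM
for every totally complex number field (`poitouTate_sum_localTatePairing_eq_zero_of_isTotallyComplex`,
2026-08-26), hence for the imaginary quadratic (Heegner) fields at which the line of record
`heegner-field-bdp-triple` v6b demands it — the registered textbook stub `stub_textbookDualityImQuad`
(filing of record `CongruentShaFreeCutTextbookDualityImQuad.stub_textbookDualityImQuad`). This file
DISCHARGES the hypothesis `hPT` of the residual's census (`MordellShaFreeCutPoitouTateImQuad.lean`,
`MordellShaFreeCutBDPTripleUpToCensus.lean`) and records what crux A and the leaf now rest on: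

* `threeAdicControlOfCorankOne_of_locNonDegeneracy` — Link A in CORANK currency
  `ThreeAdicControlOfCorankOne` ⟸ (res) at `3` ALONE (the `@[conjecture]` def of
  `MordellShaFreeCutThreeAdicLinksCorank`; Poitou–Tate and the local Euler characteristic are tree theorems);
* `cruxA_of_res_of_bdpTriple[UpTo]`, `cruxA_iff_res_of_bdpTriple[UpTo]` — **crux A ⟺ (res) at `3` modulo
  the BDP triple (exact v6b / ♯ hedge) and five refereed facts, NOTHING ELSE**;
* `leaf_of_res_of_bdpTriple[UpTo]` — **THE ROUTE'S KERNEL CENSUS: the rung-S2b leaf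
  `rankOne_threeConverse_mordellCurve` ⟸ {(res) at `3`, (LB-exist), (LB-wan), (LB-bdp)} (exact or ♯) + six
  refereed facts, NOTHING ELSE.**

HONEST FRAMING: CONDITIONAL reductions; nothing here proves crux A, crux B, the leaf, Sylvester's
conjecture or any case of BSD; (res) at `3` is the hypothesis `hres` spelled exactly as the registered
`stub_threeLocNonDegeneracy`, the three BDP statements enter by their landed names. PARTITION: none — RANK axis.

[cite: MilneADT2006, Ch. I, Thm. 4.10(b) and Thm. 2.8] [cite: CasselsFrohlichANT1967, Ch. VII §10]
[cite: Skinner2020, Thm. B, §2.2–2.3 (shape of (res))] [cite: CastellaGrossiLeeSkinner2022, §5.2 (proof of Thm. 5.2.1)]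
[cite: GrossZagier1986, Thm. I.6.3 with V.§2] -/

noncomputable section

open scoped Classical

namespace Summit.BirchSwinnertonDyer.BirchSwinnertonDyer.Theorems.MordellShaFreeCutResidualCensusPTFree

open PowerSeries WeierstrassCurve NumberField IsDedekindDomain Field Literature.NumberTheory.EllipticCurves
  Literature.NumberTheory.EllipticCurves.ModularForms Literature.NumberTheory.QuadraticFields
  Literature.NumberTheory.EllipticCurves.Castella2018
open Literature.NumberTheory.GaloisRepresentations Literature.NumberTheory.GaloisCohomology
open Summit.BirchSwinnertonDyer.BirchSwinnertonDyer.Theses.MordellShaFreeCut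
open Summit.BirchSwinnertonDyer.BirchSwinnertonDyer.Theorems.CongruentShaFreeCutTextbookDualityImQuad
  renaming stub_textbookDualityImQuad → textbookDualityImQuad
open Summit.BirchSwinnertonDyer.BirchSwinnertonDyer.Theorems.MordellShaFreeCutThreeAdicBDPTriple
  (ThreeAdicBDPElementExists ThreeAdicWanDivisibility ThreeAdicBDPValueAtOne)
open Summit.BirchSwinnertonDyer.BirchSwinnertonDyer.Theorems.MordellShaFreeCutThreeAdicBDPTripleUpTo
  (ThreeAdicBDPElementExistsUpTo ThreeAdicWanDivisibilityUpTo ThreeAdicBDPValueAtOneUpTo)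
open Summit.BirchSwinnertonDyer.BirchSwinnertonDyer.Theorems.MordellShaFreeCutThreeAdicLinksCorank
  (ThreeAdicControlOfCorankOne)
open Summit.BirchSwinnertonDyer.BirchSwinnertonDyer.Theorems.MordellShaFreeCutPoitouTateImQuad
  (threeAdicControlOfCorankOne_of_res_imaginaryQuadratic cruxA_of_res_of_bdpTriple_of_poitouTate_imaginaryQuadratic
    cruxA_iff_res_of_bdpTriple_of_poitouTate_imaginaryQuadratic leaf_of_res_of_bdpTriple_of_poitouTate_imaginaryQuadratic)
open Summit.BirchSwinnertonDyer.BirchSwinnertonDyer.Theorems.MordellShaFreeCutBDPTripleUpToCensus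
  (cruxA_of_res_of_bdpTripleUpTo_of_poitouTate_imaginaryQuadratic
    cruxA_iff_res_of_bdpTripleUpTo_of_poitouTate_imaginaryQuadratic
    leaf_of_res_of_bdpTripleUpTo_of_poitouTate_imaginaryQuadratic)

/-! ## 1. Link A in corank currency from (res) alone -/

/-- **Link A in CORANK currency `ThreeAdicControlOfCorankOne` ⟸ (res) at `3`, nothing else**: the
imaginary-quadratic glue `threeAdicControlOfCorankOne_of_res_imaginaryQuadratic` (p448851: Castella's base
Selmer group is finite from (res), corank one, Poitou–Tate and the local Euler characteristic; then the tower
control `hasCharValuationAt_of_finite_selmerAcBase`) with Poitou–Tate DISCHARGED by the tree theorem at the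
imaginary quadratic fields.  CONDITIONAL on the research statement (res) (= the registered
`stub_threeLocNonDegeneracy`, restated only as a hypothesis); credits nothing beyond the reduction.
[cite: Skinner2020, §2.3 Lemma 2.3.2 (shape)] [cite: MilneADT2006, Ch. I, Thm. 4.10(b) and Thm. 2.8] -/
theorem threeAdicControlOfCorankOne_of_locNonDegeneracy
    (hres : ∀ (W : WeierstrassCurve ℚ) [W.IsElliptic] [W.IsGloballyMinimal], W.j = 0 →
      ∀ (K : Type) [Field K] [NumberField K],
      IsImaginaryQuadratic K → SatisfiesHeegnerHypothesis 3 K →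
        (W.baseChange K).selmerCorank 3 = 1 →
      ∀ (w : HeightOneSpectrum (𝓞 K)), ((3 : ℕ) : 𝓞 K) ∈ w.asIdeal →
        Finite ↥((W.baseChange K).selmerGroupPInfty 3 ⊓
          selmerLocalKerPrimaryTorsion (W.baseChange K) (w.adicCompletion K) 3)) :
    ThreeAdicControlOfCorankOne :=
  threeAdicControlOfCorankOne_of_res_imaginaryQuadratic textbookDualityImQuad hres

/-! ## 2. Crux A ⟺ (res) modulo the BDP triple and five refereed facts -/

/-- **Crux A `RankPosOfThreeSelmerCorankOne` ⟸ (res) at `3` + (LB-exist) + (LB-wan) + (LB-bdp) + five refereed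
facts** (`3`-parity, modularity, Hoffstein–Luo, Kato, existence of Heegner points) —
`cruxA_of_res_of_bdpTriple_of_poitouTate_imaginaryQuadratic` (p448851) with its textbook hypothesis DISCHARGED.
CONDITIONAL; credits nothing beyond the reduction. [cite: Skinner2020, Thm. B and §2.2–2.3 (shape of (res))]
[cite: CastellaGrossiLeeSkinner2022, §5.2 (proof of Thm. 5.2.1)] -/
theorem cruxA_of_res_of_bdpTriple
    (hpar : ∀ (W : WeierstrassCurve ℚ) [W.IsElliptic] (p : ℕ) [Fact p.Prime], p_parity W p)
    (hmod : ModularForms.exists_isNewformOf) (hHL : HoffsteinLuo1997_exists_twist_L_one_ne_zero)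
    (hKato : ∀ (W : WeierstrassCurve ℚ) [W.IsElliptic] (p : ℕ) [Fact p.Prime],
      kato_finite_of_L_one_ne_zero W p)
    (hHP : ∀ (W : WeierstrassCurve ℚ) (K : Type) [Field K] [NumberField K],
      exists_isHeegnerPoint W K)
    (hres : ∀ (W : WeierstrassCurve ℚ) [W.IsElliptic] [W.IsGloballyMinimal], W.j = 0 →
      ∀ (K : Type) [Field K] [NumberField K],
      IsImaginaryQuadratic K → SatisfiesHeegnerHypothesis 3 K →
        (W.baseChange K).selmerCorank 3 = 1 →
      ∀ (w : HeightOneSpectrum (𝓞 K)), ((3 : ℕ) : 𝓞 K) ∈ w.asIdeal →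
        Finite ↥((W.baseChange K).selmerGroupPInfty 3 ⊓
          selmerLocalKerPrimaryTorsion (W.baseChange K) (w.adicCompletion K) 3))
    (hE : ThreeAdicBDPElementExists) (hWan : ThreeAdicWanDivisibility) (hV : ThreeAdicBDPValueAtOne) :
    RankPosOfThreeSelmerCorankOne :=
  cruxA_of_res_of_bdpTriple_of_poitouTate_imaginaryQuadratic hpar hmod hHL hKato hHP
    textbookDualityImQuad hres hE hWan hV

/-- **KERNEL CENSUS OF THE RESIDUAL (exact currency, line v6b): modulo the BDP triple and five refereed facts,
crux A `RankPosOfThreeSelmerCorankOne` ⟺ (res) at `3`** (`⟹` is the fact-free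
`MordellShaFreeCutLocNonDegeneracy.threeLocNonDegeneracy_of_cruxA`, p435058) —
`cruxA_iff_res_of_bdpTriple_of_poitouTate_imaginaryQuadratic` with its textbook hypothesis DISCHARGED.
CONDITIONAL; credits nothing beyond the reduction. [cite: Skinner2020, Thm. B and §2.2 (shape of (res))]
[cite: WZhang2014, Thm. 1.3 and Remark 2 (p. 198)] -/
theorem cruxA_iff_res_of_bdpTriple
    (hpar : ∀ (W : WeierstrassCurve ℚ) [W.IsElliptic] (p : ℕ) [Fact p.Prime], p_parity W p)
    (hmod : ModularForms.exists_isNewformOf) (hHL : HoffsteinLuo1997_exists_twist_L_one_ne_zero)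
    (hKato : ∀ (W : WeierstrassCurve ℚ) [W.IsElliptic] (p : ℕ) [Fact p.Prime],
      kato_finite_of_L_one_ne_zero W p)
    (hHP : ∀ (W : WeierstrassCurve ℚ) (K : Type) [Field K] [NumberField K],
      exists_isHeegnerPoint W K)
    (hE : ThreeAdicBDPElementExists) (hWan : ThreeAdicWanDivisibility) (hV : ThreeAdicBDPValueAtOne) :
    RankPosOfThreeSelmerCorankOne ↔
      ∀ (W : WeierstrassCurve ℚ) [W.IsElliptic] [W.IsGloballyMinimal], W.j = 0 →
        ∀ (K : Type) [Field K] [NumberField K],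
        IsImaginaryQuadratic K → SatisfiesHeegnerHypothesis 3 K →
          (W.baseChange K).selmerCorank 3 = 1 →
        ∀ (w : HeightOneSpectrum (𝓞 K)), ((3 : ℕ) : 𝓞 K) ∈ w.asIdeal →
          Finite ↥((W.baseChange K).selmerGroupPInfty 3 ⊓
            selmerLocalKerPrimaryTorsion (W.baseChange K) (w.adicCompletion K) 3) :=
  cruxA_iff_res_of_bdpTriple_of_poitouTate_imaginaryQuadratic hpar hmod hHL hKato hHP
    textbookDualityImQuad hE hWan hV

/-- **Crux A ⟸ (res) at `3` + the ♯ triple + five refereed facts** (♯ currency, the hedge p451012: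
`cruxA_of_res_of_bdpTripleUpTo_of_poitouTate_imaginaryQuadratic` with its textbook hypothesis DISCHARGED).
CONDITIONAL; credits nothing beyond the reduction. [cite: Skinner2020, Thm. B and §2.2–2.3 (shape of (res))]
[cite: CastellaGrossiLeeSkinner2022, §5.2 (proof of Thm. 5.2.1)] -/
theorem cruxA_of_res_of_bdpTripleUpTo
    (hpar : ∀ (W : WeierstrassCurve ℚ) [W.IsElliptic] (p : ℕ) [Fact p.Prime], p_parity W p)
    (hmod : ModularForms.exists_isNewformOf) (hHL : HoffsteinLuo1997_exists_twist_L_one_ne_zero)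
    (hKato : ∀ (W : WeierstrassCurve ℚ) [W.IsElliptic] (p : ℕ) [Fact p.Prime],
      kato_finite_of_L_one_ne_zero W p)
    (hHP : ∀ (W : WeierstrassCurve ℚ) (K : Type) [Field K] [NumberField K],
      exists_isHeegnerPoint W K)
    (hres : ∀ (W : WeierstrassCurve ℚ) [W.IsElliptic] [W.IsGloballyMinimal], W.j = 0 →
      ∀ (K : Type) [Field K] [NumberField K],
      IsImaginaryQuadratic K → SatisfiesHeegnerHypothesis 3 K →
        (W.baseChange K).selmerCorank 3 = 1 →
      ∀ (w : HeightOneSpectrum (𝓞 K)), ((3 : ℕ) : 𝓞 K) ∈ w.asIdeal →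
        Finite ↥((W.baseChange K).selmerGroupPInfty 3 ⊓
          selmerLocalKerPrimaryTorsion (W.baseChange K) (w.adicCompletion K) 3))
    (hE : ThreeAdicBDPElementExistsUpTo) (hWan : ThreeAdicWanDivisibilityUpTo)
    (hV : ThreeAdicBDPValueAtOneUpTo) :
    RankPosOfThreeSelmerCorankOne :=
  cruxA_of_res_of_bdpTripleUpTo_of_poitouTate_imaginaryQuadratic hpar hmod hHL hKato hHP
    textbookDualityImQuad hres hE hWan hV

/-- **KERNEL CENSUS OF THE RESIDUAL (♯ currency): modulo the ♯ triple and five refereed facts, crux A ⟺ (res)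
at `3`** — `cruxA_iff_res_of_bdpTripleUpTo_of_poitouTate_imaginaryQuadratic` with its textbook hypothesis
DISCHARGED. CONDITIONAL; credits nothing beyond the reduction. [cite: Skinner2020, Thm. B and §2.2 (shape of (res))]
[cite: WZhang2014, Thm. 1.3 and Remark 2 (p. 198)] -/
theorem cruxA_iff_res_of_bdpTripleUpTo
    (hpar : ∀ (W : WeierstrassCurve ℚ) [W.IsElliptic] (p : ℕ) [Fact p.Prime], p_parity W p)
    (hmod : ModularForms.exists_isNewformOf) (hHL : HoffsteinLuo1997_exists_twist_L_one_ne_zero)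
    (hKato : ∀ (W : WeierstrassCurve ℚ) [W.IsElliptic] (p : ℕ) [Fact p.Prime],
      kato_finite_of_L_one_ne_zero W p)
    (hHP : ∀ (W : WeierstrassCurve ℚ) (K : Type) [Field K] [NumberField K],
      exists_isHeegnerPoint W K)
    (hE : ThreeAdicBDPElementExistsUpTo) (hWan : ThreeAdicWanDivisibilityUpTo)
    (hV : ThreeAdicBDPValueAtOneUpTo) :
    RankPosOfThreeSelmerCorankOne ↔
      ∀ (W : WeierstrassCurve ℚ) [W.IsElliptic] [W.IsGloballyMinimal], W.j = 0 →
        ∀ (K : Type) [Field K] [NumberField K],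
        IsImaginaryQuadratic K → SatisfiesHeegnerHypothesis 3 K →
          (W.baseChange K).selmerCorank 3 = 1 →
        ∀ (w : HeightOneSpectrum (𝓞 K)), ((3 : ℕ) : 𝓞 K) ∈ w.asIdeal →
          Finite ↥((W.baseChange K).selmerGroupPInfty 3 ⊓
            selmerLocalKerPrimaryTorsion (W.baseChange K) (w.adicCompletion K) 3) :=
  cruxA_iff_res_of_bdpTripleUpTo_of_poitouTate_imaginaryQuadratic hpar hmod hHL hKato hHP
    textbookDualityImQuad hE hWan hV

/-! ## 3. The route's kernel census: the leaf from (res) + the BDP triple + six refereed facts -/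

/-- **THE ROUTE'S KERNEL CENSUS (exact currency): the rung-S2b leaf `rankOne_threeConverse_mordellCurve`
⟸ {(res) at `3`, (LB-exist), (LB-wan), (LB-bdp)} + six refereed facts** (`3`-parity, modularity,
Hoffstein–Luo, Kato, Gross 1984, Gross–Zagier + Kolyvagin), NOTHING ELSE —
`leaf_of_res_of_bdpTriple_of_poitouTate_imaginaryQuadratic` (p448851: the route's Assembly of crux A and
crux B) with its textbook hypothesis DISCHARGED by the tree's Poitou–Tate theorem.  CONDITIONAL on the four
research statements; neither BSD nor Sylvester's conjecture is touched. [cite: GrossZagier1986, Thm. I.6.3 with V.§2]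
[cite: CastellaGrossiLeeSkinner2022, §5.2 (proof of Thm. 5.2.1)] [cite: Skinner2020, Thm. B (shape of (res))] -/
theorem leaf_of_res_of_bdpTriple
    (hpar : ∀ (W : WeierstrassCurve ℚ) [W.IsElliptic] (p : ℕ) [Fact p.Prime], p_parity W p)
    (hmod : ModularForms.exists_isNewformOf) (hHL : HoffsteinLuo1997_exists_twist_L_one_ne_zero)
    (hKato : ∀ (W : WeierstrassCurve ℚ) [W.IsElliptic] (p : ℕ) [Fact p.Prime],
      kato_finite_of_L_one_ne_zero W p)
    (hHP : ∀ (W : WeierstrassCurve ℚ) (K : Type) [Field K] [NumberField K],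
      exists_isHeegnerPoint W K)
    (hGZ : ∀ (W : WeierstrassCurve ℚ) (N : ℕ) [NeZero N] (K : Type) [Field K] [NumberField K],
      analyticRankEK_eq_one_iff_heegner_nonTorsion W N K)
    (hres : ∀ (W : WeierstrassCurve ℚ) [W.IsElliptic] [W.IsGloballyMinimal], W.j = 0 →
      ∀ (K : Type) [Field K] [NumberField K],
      IsImaginaryQuadratic K → SatisfiesHeegnerHypothesis 3 K →
        (W.baseChange K).selmerCorank 3 = 1 →
      ∀ (w : HeightOneSpectrum (𝓞 K)), ((3 : ℕ) : 𝓞 K) ∈ w.asIdeal →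
        Finite ↥((W.baseChange K).selmerGroupPInfty 3 ⊓
          selmerLocalKerPrimaryTorsion (W.baseChange K) (w.adicCompletion K) 3))
    (hE : ThreeAdicBDPElementExists) (hWan : ThreeAdicWanDivisibility) (hV : ThreeAdicBDPValueAtOne) :
    rankOne_threeConverse_mordellCurve :=
  leaf_of_res_of_bdpTriple_of_poitouTate_imaginaryQuadratic hpar hmod hHL hKato hHP hGZ
    textbookDualityImQuad hres hE hWan hV

/-- **THE ROUTE'S KERNEL CENSUS (♯ currency): the leaf ⟸ {(res) at `3`, (LB-exist♯), (LB-wan♯), (LB-bdp♯)}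
+ six refereed facts**, NOTHING ELSE — `leaf_of_res_of_bdpTripleUpTo_of_poitouTate_imaginaryQuadratic`
(p451012) with its textbook hypothesis DISCHARGED.  CONDITIONAL; neither BSD nor Sylvester's conjecture is
touched. [cite: GrossZagier1986, Thm. I.6.3 with V.§2] [cite: CastellaGrossiLeeSkinner2022, §5.2 (proof of Thm. 5.2.1)] -/
theorem leaf_of_res_of_bdpTripleUpTo
    (hpar : ∀ (W : WeierstrassCurve ℚ) [W.IsElliptic] (p : ℕ) [Fact p.Prime], p_parity W p)
    (hmod : ModularForms.exists_isNewformOf) (hHL : HoffsteinLuo1997_exists_twist_L_one_ne_zero)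
    (hKato : ∀ (W : WeierstrassCurve ℚ) [W.IsElliptic] (p : ℕ) [Fact p.Prime],
      kato_finite_of_L_one_ne_zero W p)
    (hHP : ∀ (W : WeierstrassCurve ℚ) (K : Type) [Field K] [NumberField K],
      exists_isHeegnerPoint W K)
    (hGZ : ∀ (W : WeierstrassCurve ℚ) (N : ℕ) [NeZero N] (K : Type) [Field K] [NumberField K],
      analyticRankEK_eq_one_iff_heegner_nonTorsion W N K)
    (hres : ∀ (W : WeierstrassCurve ℚ) [W.IsElliptic] [W.IsGloballyMinimal], W.j = 0 →
      ∀ (K : Type) [Field K] [NumberField K],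
      IsImaginaryQuadratic K → SatisfiesHeegnerHypothesis 3 K →
        (W.baseChange K).selmerCorank 3 = 1 →
      ∀ (w : HeightOneSpectrum (𝓞 K)), ((3 : ℕ) : 𝓞 K) ∈ w.asIdeal →
        Finite ↥((W.baseChange K).selmerGroupPInfty 3 ⊓
          selmerLocalKerPrimaryTorsion (W.baseChange K) (w.adicCompletion K) 3))
    (hE : ThreeAdicBDPElementExistsUpTo) (hWan : ThreeAdicWanDivisibilityUpTo)
    (hV : ThreeAdicBDPValueAtOneUpTo) :
    rankOne_threeConverse_mordellCurve :=
  leaf_of_res_of_bdpTripleUpTo_of_poitouTate_imaginaryQuadratic hpar hmod hHL hKato hHP hGZ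
    textbookDualityImQuad hres hE hWan hV

end Summit.BirchSwinnertonDyer.BirchSwinnertonDyer.Theorems.MordellShaFreeCutResidualCensusPTFree

end
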